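import Literature.MathematicalPhysics.QuantumFieldTheory.Balaban1983to89.B12RegularSpaces111Gauge
import Literature.MathematicalPhysics.QuantumFieldTheory.Balaban1983to89.B12ExpSteps

/-!
# `Balaban1983to89.B12Ineq341Rotation` — T. Bałaban, *Renormalization group approach to lattice gauge field theories. I*,
Commun. Math. Phys. **109** (1987) 249–301 [Balaban1987RG1]: **the FIRST inequalities of (3.41) and (3.42) p. 278 — the cost of the
rotation `R((vū_{k+1}v_ju_j)⁻¹)`** — on the carriers of record (`B12RegularSpaces111`: plaquette variables `plaq`, gauge action `gaugeU`;
`B12RegularSpaces111Gauge.plaq_gaugeU`): until now the first inequality of (3.41) was the literal analytic-input hypothesis `h41a`/`h41` of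
`B12ExpSteps.ineq341`, `B12Plaquette343.ineq344_plaquette`/`condIII_first_plaquette[_shifted]`, `B12Lemma4Concrete.condIII_first_plaq`/
`…_region`, and the printed (3.42) the hypothesis `h42` of `B12CondIIIJ.jLadder_bound`/`condIII_second_of_inputs`.  Here both are
DERIVED from their printed ingredients: the identity (3.39) (with (3.37)) relating `exp iξ𝐇_j(□₀, Q(…))` to `U_{k+1}(□₀, M˙(𝐔))` by the
gauge transformation `(vū_{k+1}v_ju_j)⁻¹`, the bounds (3.40), and the sizes of the four transformations ((3.26) `v`, (3.27) `u_{k+1}`,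
(3.37) `u_j`, and `v_j`).

HONEST FRAMING (cell `lit-balaban`, verbatim): statement-level skeleton of published theorems with citation tags; proofs where landed; nothing here is a claim about the Yang–Mills mass gap.

PDF held: `paper:balaban1987-cmp109-rg-i-small-field` (journal page = PDF page + 248); pp. 275, 277, 278 re-read as images from the
renders `b2b-balaban-ref1/pages/1987-cmp109-rg-I-small-field/1987-cmp109-rg-I-small-field-p027/p029/p030-x2.png` by this unit.

THE PRINT, verbatim.  p. 275 (3.26): *«M˙(𝐔) = V^v, |V(b) − 1| < O(1)Mα₀, |v − 1| < O(1)Mα₁.»*; (3.27): *«U_{k+1}(□₀, V) = (exp iL⁻¹η𝐇_{k+1}(□₀,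
(1/i) log V))^{u_{k+1}}, … |u_{k+1} − 1| < B₃O(1)Mα₀ on □₀.»*  p. 277 (3.37): *«U_j(□₀, exp iτQ(L⁻¹η𝐇_{k+1})) = (exp iξ𝐇_j(□₀,
τQ(L⁻¹η𝐇_{k+1})))^{u_j}, … |u_j − 1| < B₃²O(1)Mα₀.»*  p. 278: *«Using (97) [12], (3.27), (3.26) we obtain for τ = 1  U_j(□₀, exp iQ(L⁻¹η𝐇_{k+1}))
= U_j(□₀, M˙(exp iL⁻¹η𝐇_{k+1})^{v_j⁻¹}) = U_j(□₀, M˙(U_{k+1}(□₀, M˙(𝐔))))^{v_j⁻¹(ū_{k+1})⁻¹v⁻¹} = U_{k+1}(□₀, M˙(𝐔))^{(vū_{k+1}v_j)⁻¹}.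
(3.39) The assumption that the configuration 𝐔 belongs to the space U′ᶜ_{k+1}(□₀, (1+2β)α₀, (1+β)α₁, α₀) implies in particular the
inequalities |∂U_{k+1}(□₀, M˙(𝐔)) − 1| < (1+2β)α₀(L⁻¹η)², |J_{k+1}(□₀, M˙(𝐔))| < (1+2β)α₀ on □̃³. (3.40) The first inequality, and the
identities (3.39), (3.37) imply |∂ exp iξ𝐇_j(□₀, Q(L⁻¹η𝐇_{k+1})) − 1| = |R((vū_{k+1}v_ju_j)⁻¹)(∂U_{k+1}(□₀, M˙(𝐔)) − 1)| <
exp B₃²O(1)Mα₀ exp B₃O(1)Mα₀ exp B₃O(1)Mα₀ × exp O(1)Mα₁(1+2β)α₀(L⁻¹η)² < (1+3β)α₀(L^{j−1}η)²ξ² on □̃³, (3.41) for α₁ sufficiently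
small, e.g. O(1)Mα₁ ≤ β. A similar inequality holds for the expression replacing the variable 𝐉  |D^{ξ*}_{exp iξ𝐇_j(…)}ξ⁻²π Im ∂ exp iξ𝐇_j(…)|
= |R((vū_{k+1}v_ju_j)⁻¹)(L^{j−1}η)³J_{k+1}(M˙(𝐔))| < (1+3β)α₀(L^{j−1}η)³ on □̃³. (3.42)»*

THE READING.  `R(g)X = gXg⁻¹` ([Balaban1985BackgroundPropagators] (3.3)); for a `Gᶜ`-valued gauge transformation the ROTATION COST at a
site is `‖g‖·‖g⁻¹‖` (`‖R(g)X‖ ≤ ‖g‖‖g⁻¹‖·‖X‖`, and `R(g)(X) − 1 = R(g)(X − 1)`); it is inversion-invariant and submultiplicative along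
products, so the composite `(vū_{k+1}v_ju_j)⁻¹` costs at most the product of the four individual costs.  The print assigns one
exponential factor to each transformation (a generic `O(1)` in each exponent): `u_j ↦ e^{B₃²O(1)Mα₀}` ((3.37)), `ū_{k+1} ↦ e^{B₃O(1)Mα₀}`
((3.27); `ū_{k+1}` is `u_{k+1}` made block-constant, p. 278), `v_j ↦ e^{B₃O(1)Mα₀}`, `v ↦ e^{O(1)Mα₁}` ((3.26)) — these per-transformation
cost bounds are the HYPOTHESES here (the typed constant `O₁` of `B12Sec2to5.Lemma4Consts` for every `O(1)`, as in `B12ExpSteps`); from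
(3.39)+(3.37), `exp iξ𝐇_j(□₀, Q(…)) = U_{k+1}(□₀, M˙(𝐔))^{(vū_{k+1}v_ju_j)⁻¹}`, so its plaquette variables are the rotated ones
(`plaq_gaugeU`) — the identity enters as an equality of plaquette variables (hypothesis `h339`), the functions themselves being data of [15].

WHAT IS PROVED.  §1 rotation costs in a normed ring: `norm_conj_le_cost`, `norm_conj_sub_one_le_cost`, `cost_inv`, `cost_mul_le`,
`cost_mul4_le`, `cost_composite_le` (`cost_nonneg` private).  §2 **(3.41), first inequality** for the plaquette variables of `𝐔₂^{(vū_{k+1}v_ju_j)⁻¹}`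
from (3.40) and the four cost bounds (`ineq341_first`), its transport to any configuration with the same plaquette variables — the
literal `h41` of the Lemma-4 chain DISCHARGED modulo (3.39)/(3.40)/costs (`h41_of_eq339`), and the printed last member
`< (1+3β)α₀(L^{j−1}η)²ξ²` by `B12ExpSteps.ineq341_printed` under the restrictions (`ineq341_printed_of_eq339`).  §3 **(3.42)**: the rotated,
rescaled current `R(w)((L^{j−1}η)³J_{k+1})` is `< (1+3β)α₀(L^{j−1}η)³` from «|J_{k+1}(□₀, M˙(𝐔))| < (1+2β)α₀», the cost bound and
`e^{a}(1+2β) ≤ 1+3β` (`B12ExpSteps.step341` under `Lemma4Restrictions` + the three unlisted constant hypotheses) (`ineq342`, and for a bond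
function given by that identity, `h42_of_eq342` = the hypothesis `h42` of `B12CondIIIJ`).  NOT here: the functions `U_{k+1}(□₀, M˙(𝐔))`,
`J_{k+1}`, `𝐇_j`, the transformations `v, ū_{k+1}, v_j, u_j` and the identities (3.39)/(3.37) themselves (data of [12, 15]; hypotheses),
(3.40) (hypothesis = membership of `𝐔` in `U′ᶜ_{k+1}`, the (iv)-type data bound).  No `def`, no `Prop` placeholder, no new fact; axioms
standard.  Unit `lit-balaban-p07` (Phase-2 seat p07 gen 6; TAKING line HOME/STATUS.md 2026-08-21T07:22:00Z; row B12.Eq3.37-3.47, owners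
r09/r20), HOME `run/shared/lean/pub/lit-balaban/`.
-/

namespace Literature.MathematicalPhysics.QuantumFieldTheory.Balaban1983to89.B12Ineq341Rotation

open Literature.MathematicalPhysics.QuantumFieldTheory.Balaban1983to89
open Literature.MathematicalPhysics.QuantumFieldTheory.Balaban1983to89.B12RegularSpaces111
open Literature.MathematicalPhysics.QuantumFieldTheory.Balaban1983to89.B12RegularSpaces111Gauge

noncomputable section

/-! ## §1. Rotation costs `‖g‖·‖g⁻¹‖` in a normed ring -/

section Cost

variable {𝔸 : Type*} [NormedRing 𝔸]

/-- **`‖R(g)X‖ ≤ ‖g‖‖g⁻¹‖·‖X‖`** (`R(g)X = gXg⁻¹`; submultiplicativity, no `‖1‖ = 1` needed). [cite: Balaban1987RG1, (3.41) p.278] -/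
theorem norm_conj_le_cost (g : 𝔸ˣ) (X : 𝔸) : ‖(g : 𝔸) * X * ↑g⁻¹‖ ≤ ‖(g : 𝔸)‖ * ‖(↑g⁻¹ : 𝔸)‖ * ‖X‖ := by
  calc ‖(g : 𝔸) * X * ↑g⁻¹‖ ≤ ‖(g : 𝔸) * X‖ * ‖(↑g⁻¹ : 𝔸)‖ := norm_mul_le _ _
    _ ≤ ‖(g : 𝔸)‖ * ‖X‖ * ‖(↑g⁻¹ : 𝔸)‖ := by gcongr; exact norm_mul_le _ _
    _ = ‖(g : 𝔸)‖ * ‖(↑g⁻¹ : 𝔸)‖ * ‖X‖ := by ring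

/-- **`‖R(g)X − 1‖ ≤ ‖g‖‖g⁻¹‖·‖X − 1‖`** (`R(g)X − 1 = R(g)(X − 1)`) — the form used on plaquette variables `∂𝐔 − 1`.
[cite: Balaban1987RG1, (3.41) p.278] -/
theorem norm_conj_sub_one_le_cost (g : 𝔸ˣ) (X : 𝔸) :
    ‖(g : 𝔸) * X * ↑g⁻¹ - 1‖ ≤ ‖(g : 𝔸)‖ * ‖(↑g⁻¹ : 𝔸)‖ * ‖X - 1‖ := by
  have h : (g : 𝔸) * X * ↑g⁻¹ - 1 = (g : 𝔸) * (X - 1) * ↑g⁻¹ := by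
    rw [mul_sub, sub_mul, mul_one, Units.mul_inv]
  rw [h]
  exact norm_conj_le_cost g (X - 1)

/-- Costs are nonnegative. [folklore] -/
private theorem cost_nonneg (g : 𝔸ˣ) : 0 ≤ ‖(g : 𝔸)‖ * ‖(↑g⁻¹ : 𝔸)‖ := by positivity

/-- The cost of the inverse transformation is the same: `‖g⁻¹‖‖(g⁻¹)⁻¹‖ = ‖g‖‖g⁻¹‖`. [cite: Balaban1987RG1, (3.41) p.278] -/
theorem cost_inv (g : 𝔸ˣ) : ‖((g⁻¹ : 𝔸ˣ) : 𝔸)‖ * ‖(((g⁻¹)⁻¹ : 𝔸ˣ) : 𝔸)‖ = ‖(g : 𝔸)‖ * ‖(↑g⁻¹ : 𝔸)‖ := by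
  rw [inv_inv, mul_comm]

/-- Costs are submultiplicative: `‖gh‖‖(gh)⁻¹‖ ≤ (‖g‖‖g⁻¹‖)(‖h‖‖h⁻¹‖)`. [cite: Balaban1987RG1, (3.41) p.278] -/
theorem cost_mul_le (g h : 𝔸ˣ) :
    ‖((g * h : 𝔸ˣ) : 𝔸)‖ * ‖(((g * h)⁻¹ : 𝔸ˣ) : 𝔸)‖ ≤ (‖(g : 𝔸)‖ * ‖(↑g⁻¹ : 𝔸)‖) * (‖(h : 𝔸)‖ * ‖(↑h⁻¹ : 𝔸)‖) := by
  rw [mul_inv_rev, Units.val_mul, Units.val_mul]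
  calc ‖(g : 𝔸) * ↑h‖ * ‖(↑h⁻¹ : 𝔸) * ↑g⁻¹‖ ≤ (‖(g : 𝔸)‖ * ‖(h : 𝔸)‖) * (‖(↑h⁻¹ : 𝔸)‖ * ‖(↑g⁻¹ : 𝔸)‖) :=
        mul_le_mul (norm_mul_le _ _) (norm_mul_le _ _) (norm_nonneg _) (by positivity)
    _ = (‖(g : 𝔸)‖ * ‖(↑g⁻¹ : 𝔸)‖) * (‖(h : 𝔸)‖ * ‖(↑h⁻¹ : 𝔸)‖) := by ring

/-- **The composite `vū_{k+1}v_ju_j` costs at most the product of the four costs.** [cite: Balaban1987RG1, (3.41) p.278] -/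
theorem cost_mul4_le (g₁ g₂ g₃ g₄ : 𝔸ˣ) {κ₁ κ₂ κ₃ κ₄ : ℝ} (h₁ : ‖(g₁ : 𝔸)‖ * ‖(↑g₁⁻¹ : 𝔸)‖ ≤ κ₁)
    (h₂ : ‖(g₂ : 𝔸)‖ * ‖(↑g₂⁻¹ : 𝔸)‖ ≤ κ₂) (h₃ : ‖(g₃ : 𝔸)‖ * ‖(↑g₃⁻¹ : 𝔸)‖ ≤ κ₃) (h₄ : ‖(g₄ : 𝔸)‖ * ‖(↑g₄⁻¹ : 𝔸)‖ ≤ κ₄) :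
    ‖((g₁ * g₂ * g₃ * g₄ : 𝔸ˣ) : 𝔸)‖ * ‖(((g₁ * g₂ * g₃ * g₄)⁻¹ : 𝔸ˣ) : 𝔸)‖ ≤ κ₁ * κ₂ * κ₃ * κ₄ := by
  have hκ₁ : 0 ≤ κ₁ := (cost_nonneg g₁).trans h₁
  have hκ₂ : 0 ≤ κ₂ := (cost_nonneg g₂).trans h₂
  have hκ₃ : 0 ≤ κ₃ := (cost_nonneg g₃).trans h₃
  have h12 : ‖((g₁ * g₂ : 𝔸ˣ) : 𝔸)‖ * ‖(((g₁ * g₂)⁻¹ : 𝔸ˣ) : 𝔸)‖ ≤ κ₁ * κ₂ :=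
    (cost_mul_le g₁ g₂).trans (mul_le_mul h₁ h₂ (cost_nonneg g₂) hκ₁)
  have h123 : ‖((g₁ * g₂ * g₃ : 𝔸ˣ) : 𝔸)‖ * ‖(((g₁ * g₂ * g₃)⁻¹ : 𝔸ˣ) : 𝔸)‖ ≤ κ₁ * κ₂ * κ₃ :=
    (cost_mul_le (g₁ * g₂) g₃).trans (mul_le_mul h12 h₃ (cost_nonneg g₃) (mul_nonneg hκ₁ hκ₂))
  exact (cost_mul_le (g₁ * g₂ * g₃) g₄).trans (mul_le_mul h123 h₄ (cost_nonneg g₄) (mul_nonneg (mul_nonneg hκ₁ hκ₂) hκ₃))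

end Cost

/-! ## §2. (3.41), first inequality: the rotated plaquette variables -/

section Ineq341

variable {P : Params} {i : ℕ} {𝔸 : Type*} [NormedRing 𝔸]

/-- **(3.41), first inequality.**  Let `𝐔₂ = U_{k+1}(□₀, M˙(𝐔))` satisfy the first bound of (3.40) at the plaquette `p`,
`|∂𝐔₂(p) − 1| < (1+2β)α₀(L⁻¹η)²`, and let the four transformations have rotation costs `‖u_j(x)‖‖u_j(x)⁻¹‖ ≤ e^{B₃²O(1)Mα₀}`,
`‖ū_{k+1}(x)‖‖ū_{k+1}(x)⁻¹‖ ≤ e^{B₃O(1)Mα₀}`, `‖v_j(x)‖‖v_j(x)⁻¹‖ ≤ e^{B₃O(1)Mα₀}`, `‖v(x)‖‖v(x)⁻¹‖ ≤ e^{O(1)Mα₁}` at the base point `x` of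
`p`.  Then the configuration `𝐔₂^{(vū_{k+1}v_ju_j)⁻¹}` (= `exp iξ𝐇_j(□₀, Q(…))` by (3.39), (3.37)) satisfies
`|∂(𝐔₂^{(vū_{k+1}v_ju_j)⁻¹})(p) − 1| = |R((vū_{k+1}v_ju_j)⁻¹(x))(∂𝐔₂(p) − 1)| < e^{B₃²O(1)Mα₀}e^{B₃O(1)Mα₀}e^{B₃O(1)Mα₀}e^{O(1)Mα₁}·(1+2β)α₀(L⁻¹η)²`.
[cite: Balaban1987RG1, (3.41) p.278] -/
theorem ineq341_first (c : B12Sec2to5.Lemma4Consts) {η : ℝ} {U₂ : PBond P i → 𝔸ˣ} {v ubar vj uj : Site P i → 𝔸ˣ}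
    {p : Plaq P i} (huj : ‖(uj p.src : 𝔸)‖ * ‖(↑(uj p.src)⁻¹ : 𝔸)‖ ≤ Real.exp (c.B₃ ^ 2 * c.O₁ * c.M * c.α₀))
    (hubar : ‖(ubar p.src : 𝔸)‖ * ‖(↑(ubar p.src)⁻¹ : 𝔸)‖ ≤ Real.exp (c.B₃ * c.O₁ * c.M * c.α₀))
    (hvj : ‖(vj p.src : 𝔸)‖ * ‖(↑(vj p.src)⁻¹ : 𝔸)‖ ≤ Real.exp (c.B₃ * c.O₁ * c.M * c.α₀))
    (hv : ‖(v p.src : 𝔸)‖ * ‖(↑(v p.src)⁻¹ : 𝔸)‖ ≤ Real.exp (c.O₁ * c.M * c.α₁))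
    (h340 : ‖((plaq U₂ p : 𝔸ˣ) : 𝔸) - 1‖ < (1 + 2 * c.β) * c.α₀ * (c.L⁻¹ * η) ^ 2) :
    ‖((plaq (gaugeU (v * ubar * vj * uj)⁻¹ U₂) p : 𝔸ˣ) : 𝔸) - 1‖ <
      Real.exp (c.B₃ ^ 2 * c.O₁ * c.M * c.α₀) * Real.exp (c.B₃ * c.O₁ * c.M * c.α₀) *
      Real.exp (c.B₃ * c.O₁ * c.M * c.α₀) * Real.exp (c.O₁ * c.M * c.α₁) * ((1 + 2 * c.β) * c.α₀ * (c.L⁻¹ * η) ^ 2) := by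
  set E : ℝ := Real.exp (c.B₃ ^ 2 * c.O₁ * c.M * c.α₀) * Real.exp (c.B₃ * c.O₁ * c.M * c.α₀) *
    Real.exp (c.B₃ * c.O₁ * c.M * c.α₀) * Real.exp (c.O₁ * c.M * c.α₁) with hE
  have hEpos : 0 < E := by positivity
  -- the rotation at the base point and its cost
  set w : 𝔸ˣ := ((v * ubar * vj * uj)⁻¹ : Site P i → 𝔸ˣ) p.src with hw
  have hw' : w = (v p.src * ubar p.src * vj p.src * uj p.src)⁻¹ := by
    rw [hw, Pi.inv_apply]
    rfl
  have hcost : ‖(w : 𝔸)‖ * ‖(↑w⁻¹ : 𝔸)‖ ≤ E := by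
    rw [hw', cost_inv]
    calc _ ≤ Real.exp (c.O₁ * c.M * c.α₁) * Real.exp (c.B₃ * c.O₁ * c.M * c.α₀) * Real.exp (c.B₃ * c.O₁ * c.M * c.α₀) *
          Real.exp (c.B₃ ^ 2 * c.O₁ * c.M * c.α₀) := cost_mul4_le _ _ _ _ hv hubar hvj huj
      _ = E := by rw [hE]; ring
  rw [plaq_gaugeU, Units.val_mul, Units.val_mul]
  calc ‖(w : 𝔸) * ↑(plaq U₂ p) * ↑w⁻¹ - 1‖ ≤ ‖(w : 𝔸)‖ * ‖(↑w⁻¹ : 𝔸)‖ * ‖((plaq U₂ p : 𝔸ˣ) : 𝔸) - 1‖ :=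
        norm_conj_sub_one_le_cost w _
    _ ≤ E * ‖((plaq U₂ p : 𝔸ˣ) : 𝔸) - 1‖ := mul_le_mul_of_nonneg_right hcost (norm_nonneg _)
    _ < E * ((1 + 2 * c.β) * c.α₀ * (c.L⁻¹ * η) ^ 2) := mul_lt_mul_of_pos_left h340 hEpos

/-- **The literal `h41` of the Lemma-4 chain, DISCHARGED modulo (3.39)/(3.40)/costs.**  For a configuration `𝐔₁` (in the chain:
`exp iξ𝐇_j(□₀, Q(L⁻¹η𝐇_{k+1}))`) whose plaquette variables on a set `Xp` are those of `𝐔₂^{(vū_{k+1}v_ju_j)⁻¹}` (the identity (3.39) with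
(3.37), hypothesis `h339`), the first bound of (3.40) for `𝐔₂` on `Xp` and the four cost bounds at the base points give, on `Xp`, exactly the
hypothesis `h41` of `B12Plaquette343.condIII_first_plaquette[_shifted]` / `B12Lemma4Concrete.condIII_first_region` (there with
`𝐔₁ = exp iξ𝐇`, `plaq_expI_eq_holonomy`). [cite: Balaban1987RG1, (3.41) p.278] -/
theorem h41_of_eq339 (c : B12Sec2to5.Lemma4Consts) {η : ℝ} {U₁ U₂ : PBond P i → 𝔸ˣ} {v ubar vj uj : Site P i → 𝔸ˣ}
    {Xp : Set (Plaq P i)} (h339 : ∀ p ∈ Xp, plaq U₁ p = plaq (gaugeU (v * ubar * vj * uj)⁻¹ U₂) p)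
    (huj : ∀ p ∈ Xp, ‖(uj p.src : 𝔸)‖ * ‖(↑(uj p.src)⁻¹ : 𝔸)‖ ≤ Real.exp (c.B₃ ^ 2 * c.O₁ * c.M * c.α₀))
    (hubar : ∀ p ∈ Xp, ‖(ubar p.src : 𝔸)‖ * ‖(↑(ubar p.src)⁻¹ : 𝔸)‖ ≤ Real.exp (c.B₃ * c.O₁ * c.M * c.α₀))
    (hvj : ∀ p ∈ Xp, ‖(vj p.src : 𝔸)‖ * ‖(↑(vj p.src)⁻¹ : 𝔸)‖ ≤ Real.exp (c.B₃ * c.O₁ * c.M * c.α₀))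
    (hv : ∀ p ∈ Xp, ‖(v p.src : 𝔸)‖ * ‖(↑(v p.src)⁻¹ : 𝔸)‖ ≤ Real.exp (c.O₁ * c.M * c.α₁))
    (h340 : ∀ p ∈ Xp, ‖((plaq U₂ p : 𝔸ˣ) : 𝔸) - 1‖ < (1 + 2 * c.β) * c.α₀ * (c.L⁻¹ * η) ^ 2) :
    ∀ p ∈ Xp, ‖((plaq U₁ p : 𝔸ˣ) : 𝔸) - 1‖ <
      Real.exp (c.B₃ ^ 2 * c.O₁ * c.M * c.α₀) * Real.exp (c.B₃ * c.O₁ * c.M * c.α₀) *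
      Real.exp (c.B₃ * c.O₁ * c.M * c.α₀) * Real.exp (c.O₁ * c.M * c.α₁) * ((1 + 2 * c.β) * c.α₀ * (c.L⁻¹ * η) ^ 2) := by
  intro p hp
  rw [h339 p hp]
  exact ineq341_first c (huj p hp) (hubar p hp) (hvj p hp) (hv p hp) (h340 p hp)

/-- **(3.41), both printed members**: from the same ingredients, under `Lemma4Restrictions c` + the three unlisted constant hypotheses
of `B12ExpSteps` (B₃ ≥ 1, B₃²O(1)M ≥ 1, 16·O(1)Mα₁ ≤ β — the last replacing the print's «e.g. O(1)Mα₁ ≦ β», see `B12ExpSteps`), with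
`ξ·(L^{j−1}η) = L⁻¹η`: `|∂𝐔₁(p) − 1| < (1+3β)α₀(L^{j−1}η)²ξ²` (`B12ExpSteps.ineq341_printed` supplies the last step).
[cite: Balaban1987RG1, (3.41) p.278] -/
theorem ineq341_printed_of_eq339 (c : B12Sec2to5.Lemma4Consts) (hR : B12Sec2to5.Lemma4Restrictions c)
    (hB : 1 ≤ c.B₃) (hY : 1 ≤ c.B₃ ^ 2 * c.O₁ * c.M) (hα₁ : 16 * (c.O₁ * c.M * c.α₁) ≤ c.β)
    {η ξ : ℝ} {j : ℕ} (hξx : ξ * (c.L ^ (j - 1) * η) = c.L⁻¹ * η)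
    {U₁ U₂ : PBond P i → 𝔸ˣ} {v ubar vj uj : Site P i → 𝔸ˣ} {Xp : Set (Plaq P i)}
    (h339 : ∀ p ∈ Xp, plaq U₁ p = plaq (gaugeU (v * ubar * vj * uj)⁻¹ U₂) p)
    (huj : ∀ p ∈ Xp, ‖(uj p.src : 𝔸)‖ * ‖(↑(uj p.src)⁻¹ : 𝔸)‖ ≤ Real.exp (c.B₃ ^ 2 * c.O₁ * c.M * c.α₀))
    (hubar : ∀ p ∈ Xp, ‖(ubar p.src : 𝔸)‖ * ‖(↑(ubar p.src)⁻¹ : 𝔸)‖ ≤ Real.exp (c.B₃ * c.O₁ * c.M * c.α₀))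
    (hvj : ∀ p ∈ Xp, ‖(vj p.src : 𝔸)‖ * ‖(↑(vj p.src)⁻¹ : 𝔸)‖ ≤ Real.exp (c.B₃ * c.O₁ * c.M * c.α₀))
    (hv : ∀ p ∈ Xp, ‖(v p.src : 𝔸)‖ * ‖(↑(v p.src)⁻¹ : 𝔸)‖ ≤ Real.exp (c.O₁ * c.M * c.α₁))
    (h340 : ∀ p ∈ Xp, ‖((plaq U₂ p : 𝔸ˣ) : 𝔸) - 1‖ < (1 + 2 * c.β) * c.α₀ * (c.L⁻¹ * η) ^ 2) :
    ∀ p ∈ Xp, ‖((plaq U₁ p : 𝔸ˣ) : 𝔸) - 1‖ < (1 + 3 * c.β) * c.α₀ * (c.L ^ (j - 1) * η) ^ 2 * ξ ^ 2 := by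
  intro p hp
  have hR' := hR
  unfold B12Sec2to5.Lemma4Restrictions at hR'
  obtain ⟨hα₀, _, _, _, hβ, hββ₀, hβ₀, _, _, hres10, _, _, _, _⟩ := hR'
  have hβ1 : c.β ≤ 1 := by linarith
  have hq := B12ExpSteps.exponent341_le_quarter hB hY hα₀.le hres10 hα₁
  exact B12ExpSteps.ineq341_printed hβ.le hα₀.le hξx (B12ExpSteps.small_of_quarter hβ.le hβ1 hq)
    (h41_of_eq339 c h339 huj hubar hvj hv h340 p hp)

end Ineq341

/-! ## §3. (3.42): the rotated, rescaled current -/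

section Ineq342

variable {P : Params} {i : ℕ} {𝔸 : Type*} [NormedRing 𝔸] [NormedAlgebra ℂ 𝔸]

/-- The norm of the real rescaling `(L^{j−1}η)³·J` (as a `ℂ`-scalar): `‖(x³)•J‖ = x³‖J‖` for `x ≥ 0`. [folklore] -/
private theorem norm_cube_smul {x : ℝ} (hx : 0 ≤ x) (J : 𝔸) : ‖((x : ℂ) ^ 3) • J‖ = x ^ 3 * ‖J‖ := by
  rw [norm_smul, norm_pow, Complex.norm_real, Real.norm_of_nonneg hx]

/-- **(3.42).**  For the rotated, rescaled current `R(w)((L^{j−1}η)³J₂)`, `J₂ = J_{k+1}(□₀, M˙(𝐔))(b)` with the second bound of (3.40)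
`|J₂| < (1+2β)α₀`, `w = (vū_{k+1}v_ju_j)⁻¹(b₋)` of cost at most the product of the four exponential factors, and `x = L^{j−1}η > 0`:
`|R(w)(x³J₂)| < (1+3β)α₀x³`, the constant step `e^{B₃²O(1)Mα₀ + 2B₃O(1)Mα₀ + O(1)Mα₁}(1+2β) ≤ 1+3β` being `B12ExpSteps.step341` under
`Lemma4Restrictions c` + the three unlisted constant hypotheses («for α₁ sufficiently small»). [cite: Balaban1987RG1, (3.42) p.278] -/
theorem ineq342 (c : B12Sec2to5.Lemma4Consts) (hR : B12Sec2to5.Lemma4Restrictions c)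
    (hB : 1 ≤ c.B₃) (hY : 1 ≤ c.B₃ ^ 2 * c.O₁ * c.M) (hα₁ : 16 * (c.O₁ * c.M * c.α₁) ≤ c.β)
    {x : ℝ} (hx : 0 < x) {J₂ : 𝔸} {w : 𝔸ˣ}
    (hw : ‖(w : 𝔸)‖ * ‖(↑w⁻¹ : 𝔸)‖ ≤ Real.exp (c.B₃ ^ 2 * c.O₁ * c.M * c.α₀) * Real.exp (c.B₃ * c.O₁ * c.M * c.α₀) *
      Real.exp (c.B₃ * c.O₁ * c.M * c.α₀) * Real.exp (c.O₁ * c.M * c.α₁))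
    (h340 : ‖J₂‖ < (1 + 2 * c.β) * c.α₀) :
    ‖(w : 𝔸) * (((x : ℂ) ^ 3) • J₂) * ↑w⁻¹‖ < (1 + 3 * c.β) * c.α₀ * x ^ 3 := by
  have hR' := hR
  unfold B12Sec2to5.Lemma4Restrictions at hR'
  obtain ⟨hα₀, _, _, _, hβ, hββ₀, hβ₀, _, _, hres10, _, _, _, _⟩ := hR'
  have hβ1 : c.β ≤ 1 := by linarith
  have hq := B12ExpSteps.exponent341_le_quarter hB hY hα₀.le hres10 hα₁
  have hstep := B12ExpSteps.step341 hβ.le (B12ExpSteps.small_of_quarter hβ.le hβ1 hq)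
  rw [← B12ExpSteps.factors341] at hstep
  set E : ℝ := Real.exp (c.B₃ ^ 2 * c.O₁ * c.M * c.α₀) * Real.exp (c.B₃ * c.O₁ * c.M * c.α₀) *
    Real.exp (c.B₃ * c.O₁ * c.M * c.α₀) * Real.exp (c.O₁ * c.M * c.α₁) with hE
  have hEpos : 0 < E := by positivity
  have hx3 : 0 < x ^ 3 := by positivity
  calc ‖(w : 𝔸) * (((x : ℂ) ^ 3) • J₂) * ↑w⁻¹‖ ≤ ‖(w : 𝔸)‖ * ‖(↑w⁻¹ : 𝔸)‖ * ‖((x : ℂ) ^ 3) • J₂‖ := norm_conj_le_cost w _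
    _ ≤ E * ‖((x : ℂ) ^ 3) • J₂‖ := mul_le_mul_of_nonneg_right hw (norm_nonneg _)
    _ = E * ‖J₂‖ * x ^ 3 := by rw [norm_cube_smul hx.le]; ring
    _ < E * ((1 + 2 * c.β) * c.α₀) * x ^ 3 := by
        have : E * ‖J₂‖ < E * ((1 + 2 * c.β) * c.α₀) := mul_lt_mul_of_pos_left h340 hEpos
        exact mul_lt_mul_of_pos_right this hx3
    _ = (E * (1 + 2 * c.β)) * c.α₀ * x ^ 3 := by ring
    _ ≤ (1 + 3 * c.β) * c.α₀ * x ^ 3 := by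
        have h' : (E * (1 + 2 * c.β)) * (c.α₀ * x ^ 3) ≤ (1 + 3 * c.β) * (c.α₀ * x ^ 3) :=
          mul_le_mul_of_nonneg_right hstep (by positivity)
        calc (E * (1 + 2 * c.β)) * c.α₀ * x ^ 3 = (E * (1 + 2 * c.β)) * (c.α₀ * x ^ 3) := by ring
          _ ≤ (1 + 3 * c.β) * (c.α₀ * x ^ 3) := h'
          _ = (1 + 3 * c.β) * c.α₀ * x ^ 3 := by ring

omit [NormedAlgebra ℂ 𝔸] in
/-- The cost of the composite rotation at a site from the four individual costs, in the order of (3.41)'s factors.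
[cite: Balaban1987RG1, (3.41) p.278] -/
theorem cost_composite_le (c : B12Sec2to5.Lemma4Consts) {v ubar vj uj : Site P i → 𝔸ˣ} {x : Site P i}
    (huj : ‖(uj x : 𝔸)‖ * ‖(↑(uj x)⁻¹ : 𝔸)‖ ≤ Real.exp (c.B₃ ^ 2 * c.O₁ * c.M * c.α₀))
    (hubar : ‖(ubar x : 𝔸)‖ * ‖(↑(ubar x)⁻¹ : 𝔸)‖ ≤ Real.exp (c.B₃ * c.O₁ * c.M * c.α₀))
    (hvj : ‖(vj x : 𝔸)‖ * ‖(↑(vj x)⁻¹ : 𝔸)‖ ≤ Real.exp (c.B₃ * c.O₁ * c.M * c.α₀))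
    (hv : ‖(v x : 𝔸)‖ * ‖(↑(v x)⁻¹ : 𝔸)‖ ≤ Real.exp (c.O₁ * c.M * c.α₁)) :
    ‖((((v * ubar * vj * uj)⁻¹ : Site P i → 𝔸ˣ) x : 𝔸ˣ) : 𝔸)‖ *
        ‖(((((v * ubar * vj * uj)⁻¹ : Site P i → 𝔸ˣ) x)⁻¹ : 𝔸ˣ) : 𝔸)‖ ≤
      Real.exp (c.B₃ ^ 2 * c.O₁ * c.M * c.α₀) * Real.exp (c.B₃ * c.O₁ * c.M * c.α₀) *
      Real.exp (c.B₃ * c.O₁ * c.M * c.α₀) * Real.exp (c.O₁ * c.M * c.α₁) := by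
  have e : ((v * ubar * vj * uj)⁻¹ : Site P i → 𝔸ˣ) x = (v x * ubar x * vj x * uj x)⁻¹ := by
    rw [Pi.inv_apply]
    rfl
  rw [e, cost_inv]
  calc _ ≤ Real.exp (c.O₁ * c.M * c.α₁) * Real.exp (c.B₃ * c.O₁ * c.M * c.α₀) * Real.exp (c.B₃ * c.O₁ * c.M * c.α₀) *
        Real.exp (c.B₃ ^ 2 * c.O₁ * c.M * c.α₀) := cost_mul4_le _ _ _ _ hv hubar hvj huj
    _ = _ := by ring

/-- **The hypothesis `h42` of `B12CondIIIJ`, DISCHARGED modulo the identity of (3.42), (3.40) and costs.**  For a bond function `𝐉₁`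
(in the chain: `D^{ξ*}_{exp iξ𝐇_j(…)}ξ⁻²π Im ∂ exp iξ𝐇_j(…)`) given on a bond set `Xb` by the printed identity
`𝐉₁(b) = R((vū_{k+1}v_ju_j)⁻¹(b₋))((L^{j−1}η)³J₂(b))` (hypothesis `h342`), with `|J₂(b)| < (1+2β)α₀` ((3.40)) and the four cost bounds at
`b₋`: `|𝐉₁(b)| < (1+3β)α₀(L^{j−1}η)³` on `Xb` (`0 < L^{j−1}η`). [cite: Balaban1987RG1, (3.42) p.278] -/
theorem h42_of_eq342 (c : B12Sec2to5.Lemma4Consts) (hR : B12Sec2to5.Lemma4Restrictions c)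
    (hB : 1 ≤ c.B₃) (hY : 1 ≤ c.B₃ ^ 2 * c.O₁ * c.M) (hα₁ : 16 * (c.O₁ * c.M * c.α₁) ≤ c.β)
    {η : ℝ} {j : ℕ} (hx : 0 < c.L ^ (j - 1) * η) {J₁ J₂ : PBond P i → 𝔸} {v ubar vj uj : Site P i → 𝔸ˣ}
    {Xb : Set (PBond P i)}
    (h342 : ∀ b ∈ Xb, J₁ b = ((((v * ubar * vj * uj)⁻¹ : Site P i → 𝔸ˣ) b.src : 𝔸ˣ) : 𝔸) *
      ((((c.L ^ (j - 1) * η : ℝ) : ℂ) ^ 3) • J₂ b) * ↑((((v * ubar * vj * uj)⁻¹ : Site P i → 𝔸ˣ) b.src)⁻¹ : 𝔸ˣ))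
    (huj : ∀ b ∈ Xb, ‖(uj b.src : 𝔸)‖ * ‖(↑(uj b.src)⁻¹ : 𝔸)‖ ≤ Real.exp (c.B₃ ^ 2 * c.O₁ * c.M * c.α₀))
    (hubar : ∀ b ∈ Xb, ‖(ubar b.src : 𝔸)‖ * ‖(↑(ubar b.src)⁻¹ : 𝔸)‖ ≤ Real.exp (c.B₃ * c.O₁ * c.M * c.α₀))
    (hvj : ∀ b ∈ Xb, ‖(vj b.src : 𝔸)‖ * ‖(↑(vj b.src)⁻¹ : 𝔸)‖ ≤ Real.exp (c.B₃ * c.O₁ * c.M * c.α₀))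
    (hv : ∀ b ∈ Xb, ‖(v b.src : 𝔸)‖ * ‖(↑(v b.src)⁻¹ : 𝔸)‖ ≤ Real.exp (c.O₁ * c.M * c.α₁))
    (h340 : ∀ b ∈ Xb, ‖J₂ b‖ < (1 + 2 * c.β) * c.α₀) :
    ∀ b ∈ Xb, ‖J₁ b‖ < (1 + 3 * c.β) * c.α₀ * (c.L ^ (j - 1) * η) ^ 3 := by
  intro b hb
  rw [h342 b hb]
  exact ineq342 c hR hB hY hα₁ hx (cost_composite_le c (huj b hb) (hubar b hb) (hvj b hb) (hv b hb)) (h340 b hb)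

end Ineq342

end

end Literature.MathematicalPhysics.QuantumFieldTheory.Balaban1983to89.B12Ineq341Rotation
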